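import Summits.QuantumFields.YangMills.Theorems.IsotropyFromPowerCountingTemperedCurvatureMomentsApproximantsTransfer

/-!
# `TemperedCurvatureMoments` (T, stmt-QuantumFields-17721) restated on the limit alone: T ⟺ ORDER-ZERO TEMPEREDNESS of `𝔖ₙ|⁰𝒮`

Support file of the line `Sketch` of crux T (lead c1, reshape 2), a corollary of the landed A4 machinery
(`stub_dominatedTieLimit`, p108509; `temperedApproximants_of_dominated`, p164918).

T asks, along the Wilson scheme's `(a_k, L_k)`, for TEMPERED lattice densities whose Riemann sums converge to `S₁ n` on the
off-diagonal real tensors (`TemperedApproximants sch.a sch.L S₁ n`).  This file certifies that the lattice enters only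
cosmetically: for every admissible `(a, L)` (`a_k > 0`, `a_k → 0`, `a_k L_k → ∞`),

* `temperedApproximants_iff_dominated` — `TemperedApproximants a L S₁ n ⟺ DOMINATION + REALNESS`: there are `C > 0`, `N`
  with `‖S₁ n F‖ ≤ ∫ ‖F‖ w_{C,N}` (and `‖F‖ w_{C,N} ∈ L¹`) for every `F ∈ ⁰𝒮`, where
  `w_{C,N}(y) = C (1 + ‖y‖)^N (1 + Σᵢ Σ_{j≠i} ‖yᵢ − yⱼ‖⁻¹)^N` is the tempered pair weight, and `S₁ n` is real on the
  off-diagonal real tensors.  Domination is ORDER-ZERO temperedness of the distribution `S₁ n|⁰𝒮` with polynomial growth at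
  infinity and polynomial blow-up at the coincidence locus (OS 1975's E0′-type pointwise temperedness, in weak form);
* `temperedCurvatureMoments_iff_dominated` — **T by name ⟺** for every compact simple `G`, `r`, `sch`, `S₁` with `W1`, the
  eight frames and the cone, and every `n > 0`: `S₁ n` is dominated by some tempered pair weight on `⁰𝒮` (realness being
  automatic from the tie).  No lattice density, no Riemann sum, no `(a_k, L_k)`.

So the crux is exactly: the Wilson limit's `n`-point functions, restricted to `⁰𝒮`, are order-zero distributions with the
tempered pair-weight bound — the honest substitute for Euclidean invariance E1 at Step 0 of the engines (with E1, OS0–OS3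
Schwinger functions are real-analytic off the diagonals; without it the planar-degenerate null set is invisible to reflection
positivity, cf. `Negative/TieLoadBearing.lean`).

References: K. Osterwalder, R. Schrader, Comm. Math. Phys. 42 (1975) §2 (E0′, temperedness); J. Glimm, A. Jaffe, Quantum
Physics (1987) §19.5. [folklore]
-/

noncomputable section

namespace Summit.QuantumFields.YangMills.Theorems.TemperedCurvatureMoments.Sketch

open scoped BigOperators SchwartzMap
open MeasureTheory Filter Topology Set
open Literature.MathematicalPhysics.QuantumFieldTheory Literature.MathematicalPhysics.QuantumLattice
open Literature.MathematicalPhysics.AQFT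
open Literature.Probability.LatticeModels (box Site)
open Summit.QuantumFields.YangMills.Theorems.NPointIsotropy.Negative (E4)
open Summit.QuantumFields.YangMills.Theorems.CurvatureBoostCovariance.Negative (Tie W1 EightFrameRP PlanarCone)
open Summit.QuantumFields.YangMills.Theses.IsotropyFromPowerCounting (TemperedCurvatureMoments)
open Summit.QuantumFields.YangMills.Theorems.TemperedCurvatureMoments.Negative
  (TemperedApproximants temperedCurvatureMoments_iff)
open Summit.QuantumFields.YangMills.Theorems.CurvatureBoostCovariance.BoostsInheritMirrors (stub_dominatedTieLimit)
open ApproximantsTransfer (weight_measurable_continuousOn_nonneg)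

/-- **Tempered approximants ⟺ domination + realness.**  For `n > 0`, a Schwinger family `S₁` and admissible `(a, L)`:
`S₁ n` admits tempered tied lattice approximants along `(a, L)` iff (i) for some `C > 0`, `N`, every `F ∈ ⁰𝒮` has
`‖F‖ w_{C,N}` integrable and `‖S₁ n F‖ ≤ ∫ ‖F‖ w_{C,N}`, and (ii) `S₁ n F ∈ ℝ` for every off-diagonal real tensor `F`.
(⇒: `stub_dominatedTieLimit` with the weight of the approximants, and limits of real Riemann sums are real;
⇐: `temperedApproximants_of_dominated`.) [folklore] -/
theorem temperedApproximants_iff_dominated {n : ℕ} (hn : 0 < n) (S₁ : SchwingerFamily E4) {a : ℕ → ℝ} {L : ℕ → ℕ}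
    (ha : ∀ k, 0 < a k) (ha0 : Tendsto a atTop (𝓝 0)) (haL : Tendsto (fun k => a k * L k) atTop atTop) :
    TemperedApproximants a L S₁ n ↔
      (∃ (C : ℝ) (N : ℕ), 0 < C ∧ ∀ F : 𝓢((Fin n → E4), ℂ), IsOffDiagonal F →
        Integrable (fun y => ‖F y‖ * (C * (1 + ‖y‖) ^ N *
          (1 + ∑ i, ∑ j ∈ Finset.univ.erase i, ‖y i - y j‖⁻¹) ^ N)) ∧
        ‖S₁ n F‖ ≤ ∫ y, ‖F y‖ * (C * (1 + ‖y‖) ^ N *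
          (1 + ∑ i, ∑ j ∈ Finset.univ.erase i, ‖y i - y j‖⁻¹) ^ N)) ∧
      (∀ (f : Fin n → 𝓢(E4, ℝ)) (F : 𝓢((Fin n → E4), ℂ)),
        IsTensorOf F (fun i => ofRealTest (f i)) → IsOffDiagonal F → (S₁ n F).im = 0) := by
  constructor
  · rintro ⟨D, C, N, k₀, hC, hD, htie⟩
    obtain ⟨hwm, hwc, hw0⟩ := weight_measurable_continuousOn_nonneg n hC N
    refine ⟨⟨C, N, hC, stub_dominatedTieLimit n hn (S₁ n) a L D _ C N k₀ ha ha0 haL hwm hwc hw0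
      (fun y _ => le_rfl) hD htie⟩, fun f F hF hF' => ?_⟩
    exact (isClosed_eq Complex.continuous_im continuous_const : IsClosed {z : ℂ | z.im = 0}).mem_of_tendsto
      (htie f F hF hF') (Eventually.of_forall fun _ => Complex.ofReal_im _)
  · rintro ⟨⟨C, N, hC, hdom⟩, hreal⟩
    exact temperedApproximants_of_dominated hn S₁ hC hdom hreal ha ha0 haL

variable {G : Type} [Group G] [TopologicalSpace G] [IsTopologicalGroup G] [CompactSpace G]
  [MeasurableSpace G] [BorelSpace G]

/-- Along a tied scheme, `S₁ n` is real on the off-diagonal real tensors of positive degree (limits of real lattice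
`n`-point functions). [folklore] -/
theorem im_apply_eq_zero_of_tie (r : LatticeRep G) (sch : SpeciesScheme (YMSpecies G)) (S₁ : SchwingerFamily E4)
    (htie : Tie r sch S₁) {n : ℕ} (hn : 0 < n) (f : Fin n → 𝓢(E4, ℝ)) (F : 𝓢((Fin n → E4), ℂ))
    (hF : IsTensorOf F (fun i => ofRealTest (f i))) (hF' : IsOffDiagonal F) : (S₁ n F).im = 0 :=
  (isClosed_eq Complex.continuous_im continuous_const : IsClosed {z : ℂ | z.im = 0}).mem_of_tendsto
    (htie n hn.ne' f F hF hF') (Eventually.of_forall fun _ => Complex.ofReal_im _)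

/-- **T ⟺ order-zero temperedness of the Wilson limit on `⁰𝒮`.**  `TemperedCurvatureMoments` BY NAME is equivalent to:
for every compact simple `G`, `r`, `sch`, `S₁` with `W1 r sch S₁`, the eight frames and the cone, and every `n > 0`, there
are `C > 0` and `N` such that every `F ∈ ⁰𝒮((ℝ⁴)ⁿ)` has `‖F‖ w_{C,N} ∈ L¹` and
`‖S₁ n F‖ ≤ ∫ ‖F(y)‖ · C (1 + ‖y‖)^N (1 + Σᵢ Σ_{j≠i} ‖yᵢ − yⱼ‖⁻¹)^N dy`.  The lattice data `(a_k, L_k)` of T are idle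
(`temperedApproximants_iff_dominated`; realness from the tie, `im_apply_eq_zero_of_tie`). [folklore] -/
theorem temperedCurvatureMoments_iff_dominated :
    TemperedCurvatureMoments ↔
      ∀ (G : Type) [Group G] [TopologicalSpace G] [IsTopologicalGroup G] [CompactSpace G]
        [MeasurableSpace G] [BorelSpace G], IsCompactSimpleLieGroup G →
        ∀ (r : LatticeRep G) (sch : SpeciesScheme (YMSpecies G)) (S₁ : SchwingerFamily E4),
          W1 r sch S₁ → EightFrameRP S₁ → PlanarCone S₁ → ∀ n : ℕ, 0 < n →
          ∃ (C : ℝ) (N : ℕ), 0 < C ∧ ∀ F : 𝓢((Fin n → E4), ℂ), IsOffDiagonal F →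
            Integrable (fun y => ‖F y‖ * (C * (1 + ‖y‖) ^ N *
              (1 + ∑ i, ∑ j ∈ Finset.univ.erase i, ‖y i - y j‖⁻¹) ^ N)) ∧
            ‖S₁ n F‖ ≤ ∫ y, ‖F y‖ * (C * (1 + ‖y‖) ^ N *
              (1 + ∑ i, ∑ j ∈ Finset.univ.erase i, ‖y i - y j‖⁻¹) ^ N) := by
  rw [temperedCurvatureMoments_iff]
  constructor
  · intro h G _ _ _ _ _ _ hG r sch S₁ hW h8 hC n hn
    exact ((temperedApproximants_iff_dominated hn S₁ sch.a_pos sch.tendsto_a sch.tendsto_L).1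
      (h G hG r sch S₁ hW h8 hC n hn)).1
  · intro h G _ _ _ _ _ _ hG r sch S₁ hW h8 hC n hn
    exact (temperedApproximants_iff_dominated hn S₁ sch.a_pos sch.tendsto_a sch.tendsto_L).2
      ⟨h G hG r sch S₁ hW h8 hC n hn, fun f F hF hF' => im_apply_eq_zero_of_tie r sch S₁ hW.1 hn f F hF hF'⟩

end Summit.QuantumFields.YangMills.Theorems.TemperedCurvatureMoments.Sketch

end
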